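import Summits.HubbardSuperconductivity.HubbardSuperconductivity.Theorems.AnisotropyChordTransferFibre3FinX3Eval

/-!
# Route `AnisotropyChord` / H0 rotor rung: FIN per-`L` GM₃ (X5), `L = 30` — rows `N₁` / D / side-condition cell facts, part `p31`

Kernel facts (`decide +kernel`) for cert cells 82, 83 of the per-`L` grid of `L = 30`: `xbnCellAny2` (row `N₁` on XB2 point wedges recomputed in the kernel, exporting the literal brackets `nt ⊇ T⁺ − 3λ₂` and `tb ⊇ T⁺·D`), `xdCellAnyN0` (row D, reads `nt`), `sdCellAnyZN` (side condition, reads `nt`); evaluators `…FinX3Eval` / `…FinX5Eval`; constants from the compiled design probe (x3probe/x3plan, margins c ×0.985, b ×1.03, aD ×1.03); assembled in `…FinX5GM3Thirty`.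
Prover seat `hubbard-h0-rotor-p3` g8; helper for piece A = stmt-HubbardSuperconductivity-23918 of rung 19089 (`--supports`, helper class).
WHAT THIS IS NOT: nothing here proves superconductivity in the Hubbard model (rotor TARGET as worded stays FALSE, g15 verdict); kernel facts for the FIN certificate of ONE conditional reduction.  Tree imports only; zero data; standard axioms.
-/

set_option linter.dupNamespace false
set_option autoImplicit false

namespace Summit.HubbardSuperconductivity.HubbardSuperconductivity.Theorems.AnisotropyChord.Transfer.Fibre3

namespace FinXD

open FinXB FinCell Hole2

set_option maxHeartbeats 4000000 in
/-- row `N₁` of cell 82 of `L = 30` (`c = 121/200`), exporting `nt`, `tb`. [folklore] -/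
theorem xn30_82 : xbnCellAny2 30 (49/50 : ℚ) 438802191921281 449772246719314 (121/200 : ℚ) ((-554924726001 : ℤ), (3091533000742 : ℤ)) ((1315843616329738 : ℤ), (1352416307866788 : ℤ)) = true := by decide +kernel

set_option maxHeartbeats 4000000 in
/-- row D of cell 82 of `L = 30` (`aD = 83/1000`). [folklore] -/
theorem xd30_82 : xdCellAnyN0 30 (49/50 : ℚ) 438802191921281 449772246719314 (83/1000 : ℚ) ((-554924726001 : ℤ), (3091533000742 : ℤ)) = true := by decide +kernel

set_option maxHeartbeats 4000000 in
/-- side condition of cell 82 of `L = 30` (`c, b = 65/100, aD`). [folklore] -/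
theorem sd30_82 : sdCellAnyZN 30 (49/50 : ℚ) 100 438802191921281 449772246719314 ((121/200 : ℚ), (65 : ℕ), (83/1000 : ℚ)) ((-554924726001 : ℤ), (3091533000742 : ℤ)) = true := by decide +kernel

set_option maxHeartbeats 4000000 in
/-- row `N₁` of cell 83 of `L = 30` (`c = 121/200`), exporting `nt`, `tb`. [folklore] -/
theorem xn30_83 : xbnCellAny2 30 (49/50 : ℚ) 449772246719314 461016552887297 (121/200 : ℚ) ((-464829557092 : ℤ), (3182349989043 : ℤ)) ((1348843675025043 : ℤ), (1386240244226741 : ℤ)) = true := by decide +kernel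

set_option maxHeartbeats 4000000 in
/-- row D of cell 83 of `L = 30` (`aD = 83/1000`). [folklore] -/
theorem xd30_83 : xdCellAnyN0 30 (49/50 : ℚ) 449772246719314 461016552887297 (83/1000 : ℚ) ((-464829557092 : ℤ), (3182349989043 : ℤ)) = true := by decide +kernel

set_option maxHeartbeats 4000000 in
/-- side condition of cell 83 of `L = 30` (`c, b = 66/100, aD`). [folklore] -/
theorem sd30_83 : sdCellAnyZN 30 (49/50 : ℚ) 100 449772246719314 461016552887297 ((121/200 : ℚ), (66 : ℕ), (83/1000 : ℚ)) ((-464829557092 : ℤ), (3182349989043 : ℤ)) = true := by decide +kernel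

end FinXD

end Summit.HubbardSuperconductivity.HubbardSuperconductivity.Theorems.AnisotropyChord.Transfer.Fibre3
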